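import Summits.QuantumFields.YangMills.Theorems.BalabanUVNodesN19TargetAtRecord11Home
import Summits.QuantumFields.YangMills.Theorems.BalabanUVNodesRateCarriersOfRecord11

/-!
# YM-DAG node N19 (= NE7 proper) AT BOTH HOMES OF THE RATE-RECORD DIVISION — the knit `Spine.NE7.Core → HybridNE7.matchingModConstants` with the
# SIX IN-EDGES BY NAME at the (T-RATE) home `YMDAG.UVSplit.RRec₁₁ 𝔯` (dag-n22-e, p457330) and the spine carriers at the (T-SPINE) home through its
# CANONICAL reading `SRec₁₁ (canonReading₁₁ cr)` (dag-n20-e, p454411 ∕ p456575): the SAME-KEY N19′ edge at NODE 00's objects, and its honest twin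

Cell `pub-ymgap`, HUMAN RULING D-0062 (Track A), R134 acceleration seat `pub-ymgap-dag-n19-d` (s2), module 5 (module 4 = `BalabanUVNodesN19TargetAtRecord11Home`,
modules 1–3 = `BalabanUVNodesN19TargetAtRecord11{,Currency}`, `BalabanUVNodesN19BudgetRoadAtRecord11`).  `--supports stmt-QuantumFields-19676` (K3
«SpineGivenEndpointR11»).  COUNT-NEUTRAL; NOT a discharge claim; THEOREMS ONLY, 0 `def`, 0 `sorry`; restate-immune (no route file imported).

THE TWO HOMES (dag-lead WORDS-99 ∕ WORDS-101; node00-def-RR-2's key `Node00.IsDatumOfRecord₁₁C F N D` with canonical parameter `h.params`, `Node00/Record11DatumKey`).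
* (T-RATE) `RRec₁₁ 𝔯 F D g₀ os R :↔ ∃ (h : IsDatumOfRecord₁₁C F N D) (k : ℕ), R = rateCarriersOfRecord₁₁ 𝔯 F h.params g₀ os k` — DATUM-KEYED: every run length `k`
  of ONE object tower read from the residual rate reading `𝔯` AT THE CANONICAL PARAMETER of the datum.
* (T-SPINE) `SRec₁₁ cr F D g₀ os S :↔ ∃ θ hP, θ.Admissible ∧ D = datumOfRecord₁₁ F N θ hP ∧ S = cr F θ hP g₀ os` — TUPLE-KEYED (every admissible θ realising
  `D`); its canonicalisation `SRec₁₁ (canonReading₁₁ cr)` pins exactly `cr F h.params h.provisos g₀ os` (`sRec₁₁_canon_iff`) — DATUM-KEYED.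
The K4 → K5 join (n27-a XIV `spine_of_rateStubs_coreEdge`, module 1's `stringwiseMatching_at_record₁₁_of_rateStubs`) reads a spine bundle `S` and a rate bundle
`R` pinned AT THE SAME `(F, D, g₀, os)`.  So (§1, node00-def-RR-2's located point READ AT THE ACTUAL HOMES): at the tuple-keyed spine home the N19′ edge
binder `hedgeR` says «rates at the CANONICAL parameter θ* of θ's datum ⇒ Core on `cr θ` for EVERY θ realising that datum» (`rateEdge_sRec₁₁_rRec₁₁_iff` —
the datum does not determine the tuple, so this is MORE than a same-run statement); at the canonical spine home it IS the same-key edge «for every datum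
key `h`, every `g₀`, `os`, every run length `k`: the six in-edges `RatesAt D (rateCarriersOfRecord₁₁ 𝔯 F h.params g₀ os k)` give SOME summable `δ` carrying
`Spine.NE7.Core` on the shell-free cores of `cr F h.params h.provisos g₀ os`» (`rateEdge_canon_rRec₁₁_iff`), which a consumer proves in θ-FORM at every
admissible tuple (`rateEdge_canon_rRec₁₁_of_forall_admissible`, RR-2's `IsDatumOfRecord₁₁C.forall_params`).  (The edge asks Core from the rates at ONE
run length `k` — that is K4's hook `RateInputs (RRec₁₁ 𝔯)` as n22-e typed it, `rateInputs_rRec₁₁_iff`; the letter block is K-uniform by construction.)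

WHAT IS KERNEL-CHECKED ([bookkeeping] over tree theorems BY NAME).
* §1 two MASTER FACES for pair binders at the homes (`forall_sRec₁₁_rRec₁₁_iff`, `forall_canon_rRec₁₁_iff` — how ANY binder over `(S, R)`, e.g. N19's
  link reading `hlink` of `N19RateEdgeByName.rateEdge_of_linkReading_byName`, reads at NODE 00's objects) and the three edge faces above.
* §2 N19's DECL TARGET AT BOTH HOMES: `matchingUnder_at_homes₁₁_of_rateStubs` — `S_N14` · `S_N15` · `S_N16` · `S_N17` · `S_N18` · `S_N22` at `RRec₁₁ 𝔯` BY NAME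
  (n22-e's `s_N1x_rRec₁₁_iff` faces feed them; `S_R00x ₁₁C (RRec₁₁ 𝔯)` is n22-e's THEOREM `s_R00x_rRec₁₁`, consumed here, no longer a hypothesis), `S_N27x ₁₁C`
  · `S_N20` · `S_N21` at `SRec₁₁ (canonReading₁₁ cr)`, and the SAME-KEY edge ⇒ `T4ApexVariance.MatchingUnder D END` at every `Node00.IsRecordOfRecord₁₁C F N D w`
  (n27-a XIV at the homes, then node U5 under the prefix at the record by n23-b's `T4MatchingDegenerate.hybridNE7Under_iff_matchingUnder`); the literal
  `HybridNE7.lt_one`-filling variant `matchingUnder_at_homes₁₁_of_rateStubs_lt_one` (module 1's `stringwiseMatching_at_record₁₁_of_rateStubs`, :183 by name,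
  with the keyed budget half).
* §3 FROM THE CHILDREN's θ-FORM PRODUCTS: `matchingUnder_at_homes₁₁_of_forall_admissible` — N20 ∕ N21 at `cr F θ hP g₀ os` for every admissible θ with provisos
  (the RHS of n20-e's `s_N20_sRec₁₁_iff` ∕ n21-d's `s_N21_keyed₁₁_iff`), the six rate stubs at `RRec₁₁ 𝔯`, the same-key edge in θ-form, and the keyed extraction
  clause under the prefix (n27-c XXII's `hx` shape) ⇒ the same conclusion; the canonical transfers `s_N21_sRec₁₁_canon_of_forall` ∕ `s_N27x_sRec₁₁_canon_of_forall`
  are proved here (N20's is n20-e's `s_N20_sRec₁₁_canon_of_sRec₁₁`).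

HONEST FRAMING.  Kernel bookkeeping over hypothesis SHAPES; 0 `def`, 0 `sorry`, standard axioms.  NE7 is NOT PRINTED for the d = 4 procedure and NOT
PROVED; `cr` and `𝔯` are RESIDUAL readings (no spine reading of Bałaban's dressed two-run expansion and no rate objects of record are pinned today:
dag-n20-e LOCATED (F1)–(F4), n22-e's header, W1's `HistoryTermsOfRecord` first step); every stub at either home and the same-key edge are HYPOTHESES —
0∕1 today, «a skeleton quoting `S_N14 (RRec₁₁ 𝔯)` NAMES its `𝔯`» (n14-d ∕ n22-e); nothing of Bałaban's is asserted or instantiated; N19 NOT discharged;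
Track A count unmoved (5∕27).  VACUITY STATUS AT ₁₁ AS PINNED (dag-ref-D A2, dag-lead ★FLAG l.≈12485, director-ym №81∕82, ref-F READ-17 (A2)): every
conclusion below is `MatchingUnder D END = (B) → END → …`, (B)-guarded like K3 itself — thin at windowed ₁₁C records until the ₁₂ re-pin (`Record12`);
no proof here consumes (B) except by handing it to `S_N27x` ∕ K4 by name; the file is written against the home INTERFACE names and re-instantiates at ₁₂
by substitution.  One finite four-torus at fixed ε, rung (B)+1 — NOT infinite volume, NOT OS on ℝ⁴, NOT a mass gap, NOT Clay.  No cite tags.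
-/

set_option autoImplicit false

noncomputable section

open Finset

namespace Summit.QuantumFields.YangMills.BalabanUVNodes.N19TargetAtHomes11

open Literature.MathematicalPhysics.QuantumFieldTheory.Balaban1983to89
open Literature.MathematicalPhysics.QuantumFieldTheory.Balaban1983to89.T4Continuum
open T4WeightBudget (RelWeightBound)
open T4IndicatorShell (ShellWeightBound)
open T4ContinuumYM4Torus (ForSmallCouplings)
open T4ApexVariance (MatchingUnder)
open Summit.QuantumFields.BalabanUV.T4Continuum.Spine
open Summit.QuantumFields.YangMills.BalabanUVNodes.N19TargetAtRecord11 (avgMeasurable_of_isRecordOfRecord₁₁C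
  stringwiseMatching_at_record₁₁_of_rateStubs)
open Summit.QuantumFields.YangMills.Theorems.BalabanUVNodesN27SpineRecord (spine_of_rateStubs_coreEdge)
open YMDAG.UVSplit (Datum SpineCarriers RateCarriers RatesAt S_N27x S_N20 S_N21 S_N14 S_N15 S_N16 S_N17 S_N18 S_N22 SpineReading₁₁ SRec₁₁
  sRec₁₁_self sRec₁₁_canon_iff canonReading₁₁ RateReading₁₁ rateCarriersOfRecord₁₁ RRec₁₁ s_R00x_rRec₁₁ s_N20_sRec₁₁_iff s_N20_sRec₁₁_canon_of_sRec₁₁)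
open Node00 (Stage11Params datumOfRecord₁₁ IsRecordOfRecord₁₁C IsDatumOfRecord₁₁C)

variable {N : ℕ} [NeZero N] (cr : SpineReading₁₁ N) (𝔯 : RateReading₁₁ N)

/-! ## §1 The N19′ edge binder READ AT THE TWO HOMES -/

section Edge

/-- **MASTER FACE FOR THE PAIR (tuple-keyed spine home, datum-keyed rate home)** [bookkeeping]: a clause `P` over the pairs `(S, R)` the two homes pin at the
same `(F, D, g₀, os)` IS the clause at `(cr F θ hP g₀ os, rateCarriersOfRecord₁₁ 𝔯 F h.params g₀ os k)` for every admissible θ with provisos, every key `h` of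
θ's datum and every run length `k` — the shape in which ANY pair binder of the join (N19's link reading `hlink` of `N19RateEdgeByName.rateEdge_of_linkReading_byName`,
the edge `hedgeR`) reads at these homes. [folklore] -/
theorem forall_sRec₁₁_rRec₁₁_iff (P : (F : T4Family) → Datum F N → (ℕ → ℝ) → List (ULoop F) → SpineCarriers → RateCarriers N → Prop) :
    (∀ (F : T4Family) (D : Datum F N) (g₀ : ℕ → ℝ) (os : List (ULoop F)) (S : SpineCarriers) (R : RateCarriers N),
        SRec₁₁ cr F D g₀ os S → RRec₁₁ 𝔯 F D g₀ os R → P F D g₀ os S R) ↔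
      ∀ (F : T4Family) (θ : Stage11Params F N) (hP : θ.Provisos₁₁), θ.Admissible → ∀ (g₀ : ℕ → ℝ) (os : List (ULoop F))
        (h : IsDatumOfRecord₁₁C F N (datumOfRecord₁₁ F N θ hP)) (k : ℕ),
        P F (datumOfRecord₁₁ F N θ hP) g₀ os (cr F θ hP g₀ os) (rateCarriersOfRecord₁₁ 𝔯 F h.params g₀ os k) := by
  constructor
  · intro H F θ hP hθ g₀ os h k
    exact H F _ g₀ os _ _ (sRec₁₁_self cr θ hP hθ g₀ os) ⟨h, k, rfl⟩
  · rintro H F D g₀ os S R ⟨θ, hP, hθ, rfl, rfl⟩ ⟨h, k, rfl⟩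
    exact H F θ hP hθ g₀ os h k

/-- **MASTER FACE FOR THE CANONICAL PAIR (both homes datum-keyed)** [bookkeeping]: a clause `P` over the pairs the CANONICAL spine home and the rate home pin at
the same `(F, D, g₀, os)` IS the clause at `(cr F h.params h.provisos g₀ os, rateCarriersOfRecord₁₁ 𝔯 F h.params g₀ os k)` for every datum key `h` and run
length `k` — ONE parameter for both bundles. [folklore] -/
theorem forall_canon_rRec₁₁_iff (P : (F : T4Family) → Datum F N → (ℕ → ℝ) → List (ULoop F) → SpineCarriers → RateCarriers N → Prop) :
    (∀ (F : T4Family) (D : Datum F N) (g₀ : ℕ → ℝ) (os : List (ULoop F)) (S : SpineCarriers) (R : RateCarriers N),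
        SRec₁₁ (canonReading₁₁ cr) F D g₀ os S → RRec₁₁ 𝔯 F D g₀ os R → P F D g₀ os S R) ↔
      ∀ (F : T4Family) (D : Datum F N) (h : IsDatumOfRecord₁₁C F N D) (g₀ : ℕ → ℝ) (os : List (ULoop F)) (k : ℕ),
        P F D g₀ os (cr F h.params h.provisos g₀ os) (rateCarriersOfRecord₁₁ 𝔯 F h.params g₀ os k) := by
  constructor
  · intro H F D h g₀ os k
    exact H F D g₀ os _ _ ((sRec₁₁_canon_iff cr D g₀ os _).mpr ⟨h, rfl⟩) ⟨h, k, rfl⟩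
  · intro H F D g₀ os S R hS hR
    obtain ⟨h, rfl⟩ := (sRec₁₁_canon_iff cr D g₀ os S).mp hS
    obtain ⟨h', k, rfl⟩ := hR
    exact H F D h g₀ os k

/-- **THE EDGE BINDER AT THE TUPLE-KEYED SPINE HOME AND THE DATUM-KEYED RATE HOME, READ HONESTLY** [bookkeeping].  Module 1's `hedgeR` at
`(SRec₁₁ cr, RRec₁₁ 𝔯)` ⟺ «for every admissible Stage-11 θ with provisos, every `g₀`, `os`, every datum key `h` OF θ's DATUM and every run length `k`: the six
in-edges at the rate bundle read at the CANONICAL parameter `h.params` give SOME summable `δ` with `Spine.NE7.Core` on the shell-free cores of `cr F θ hP g₀ os`»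
— θ and `h.params` realise the same datum but need not coincide (node00-def-RR-2's located point, at the actual homes); the same-key form is the next face.
[folklore] -/
theorem rateEdge_sRec₁₁_rRec₁₁_iff :
    (∀ (F : T4Family) (D : Datum F N) (g₀ : ℕ → ℝ) (os : List (ULoop F)) (S : SpineCarriers) (R : RateCarriers N),
        SRec₁₁ cr F D g₀ os S → RRec₁₁ 𝔯 F D g₀ os R → RatesAt D R → letI := S.dec
        ∃ δ : ℕ → ℝ, NE7.Core S.l₀ S.vol S.T S.Bad (fun K t τ => S.A K t τ - S.shA K t τ)
          (fun K t τ => S.B K t τ - S.shB K t τ) δ ∧ Summable δ) ↔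
      ∀ (F : T4Family) (θ : Stage11Params F N) (hP : θ.Provisos₁₁), θ.Admissible → ∀ (g₀ : ℕ → ℝ) (os : List (ULoop F))
        (h : IsDatumOfRecord₁₁C F N (datumOfRecord₁₁ F N θ hP)) (k : ℕ),
        RatesAt (datumOfRecord₁₁ F N θ hP) (rateCarriersOfRecord₁₁ 𝔯 F h.params g₀ os k) → letI := (cr F θ hP g₀ os).dec
        ∃ δ : ℕ → ℝ, NE7.Core (cr F θ hP g₀ os).l₀ (cr F θ hP g₀ os).vol (cr F θ hP g₀ os).T (cr F θ hP g₀ os).Bad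
          (fun K t τ => (cr F θ hP g₀ os).A K t τ - (cr F θ hP g₀ os).shA K t τ)
          (fun K t τ => (cr F θ hP g₀ os).B K t τ - (cr F θ hP g₀ os).shB K t τ) δ ∧ Summable δ := by
  constructor
  · intro H F θ hP hθ g₀ os h k hr
    exact H F _ g₀ os _ _ (sRec₁₁_self cr θ hP hθ g₀ os) ⟨h, k, rfl⟩ hr
  · rintro H F D g₀ os S R ⟨θ, hP, hθ, rfl, rfl⟩ ⟨h, k, rfl⟩ hr
    exact H F θ hP hθ g₀ os h k hr

/-- **THE SAME-KEY EDGE AT THE CANONICAL SPINE HOME** [bookkeeping].  Module 1's `hedgeR` at `(SRec₁₁ (canonReading₁₁ cr), RRec₁₁ 𝔯)` ⟺ «for every family,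
every datum of record `D` with key `h`, every `g₀`, `os`, every run length `k`: the six in-edges `RatesAt D (rateCarriersOfRecord₁₁ 𝔯 F h.params g₀ os k)` give
SOME summable `δ` carrying `Spine.NE7.Core` on the shell-free cores of `cr F h.params h.provisos g₀ os`» — spine AND rate carriers read AT THE SAME parameter
(one bundle per datum: `sRec₁₁_canon_iff`, proof irrelevance of the key).  THIS is the N19′ edge of the join at NODE 00's objects. [folklore] -/
theorem rateEdge_canon_rRec₁₁_iff :
    (∀ (F : T4Family) (D : Datum F N) (g₀ : ℕ → ℝ) (os : List (ULoop F)) (S : SpineCarriers) (R : RateCarriers N),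
        SRec₁₁ (canonReading₁₁ cr) F D g₀ os S → RRec₁₁ 𝔯 F D g₀ os R → RatesAt D R → letI := S.dec
        ∃ δ : ℕ → ℝ, NE7.Core S.l₀ S.vol S.T S.Bad (fun K t τ => S.A K t τ - S.shA K t τ)
          (fun K t τ => S.B K t τ - S.shB K t τ) δ ∧ Summable δ) ↔
      ∀ (F : T4Family) (D : Datum F N) (h : IsDatumOfRecord₁₁C F N D) (g₀ : ℕ → ℝ) (os : List (ULoop F)) (k : ℕ),
        RatesAt D (rateCarriersOfRecord₁₁ 𝔯 F h.params g₀ os k) → letI := (cr F h.params h.provisos g₀ os).dec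
        ∃ δ : ℕ → ℝ, NE7.Core (cr F h.params h.provisos g₀ os).l₀ (cr F h.params h.provisos g₀ os).vol (cr F h.params h.provisos g₀ os).T
          (cr F h.params h.provisos g₀ os).Bad
          (fun K t τ => (cr F h.params h.provisos g₀ os).A K t τ - (cr F h.params h.provisos g₀ os).shA K t τ)
          (fun K t τ => (cr F h.params h.provisos g₀ os).B K t τ - (cr F h.params h.provisos g₀ os).shB K t τ) δ ∧ Summable δ := by
  constructor
  · intro H F D h g₀ os k hr
    exact H F D g₀ os _ _ ((sRec₁₁_canon_iff cr D g₀ os _).mpr ⟨h, rfl⟩) ⟨h, k, rfl⟩ hr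
  · intro H F D g₀ os S R hS hR hr
    obtain ⟨h, rfl⟩ := (sRec₁₁_canon_iff cr D g₀ os S).mp hS
    obtain ⟨h', k, rfl⟩ := hR
    exact H F D h g₀ os k hr

/-- **THE θ-FORM SUPPLIES THE SAME-KEY EDGE** [bookkeeping]: if for EVERY admissible Stage-11 θ with provisos, every `g₀`, `os` and run length `k` the six
in-edges at `rateCarriersOfRecord₁₁ 𝔯 F θ g₀ os k` on θ's datum give the ∃δ-Core clause on `cr F θ hP g₀ os` (what an N19′ prover states at the objects —
n27-c XXII's `h19` with `rr := (rateCarriersOfRecord₁₁ 𝔯 · · · · k)`), then module 1's `hedgeR` holds at `(SRec₁₁ (canonReading₁₁ cr), RRec₁₁ 𝔯)`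
(RR-2's `IsDatumOfRecord₁₁C.forall_params`: proved at every admissible θ ⟹ carried at the canonical one). [folklore] -/
theorem rateEdge_canon_rRec₁₁_of_forall_admissible
    (h19 : ∀ (F : T4Family) (θ : Stage11Params F N) (hP : θ.Provisos₁₁), θ.Admissible → ∀ (g₀ : ℕ → ℝ) (os : List (ULoop F)) (k : ℕ),
      RatesAt (datumOfRecord₁₁ F N θ hP) (rateCarriersOfRecord₁₁ 𝔯 F θ g₀ os k) → letI := (cr F θ hP g₀ os).dec
      ∃ δ : ℕ → ℝ, NE7.Core (cr F θ hP g₀ os).l₀ (cr F θ hP g₀ os).vol (cr F θ hP g₀ os).T (cr F θ hP g₀ os).Bad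
        (fun K t τ => (cr F θ hP g₀ os).A K t τ - (cr F θ hP g₀ os).shA K t τ)
        (fun K t τ => (cr F θ hP g₀ os).B K t τ - (cr F θ hP g₀ os).shB K t τ) δ ∧ Summable δ)
    (F : T4Family) (D : Datum F N) (g₀ : ℕ → ℝ) (os : List (ULoop F)) (S : SpineCarriers) (R : RateCarriers N)
    (hS : SRec₁₁ (canonReading₁₁ cr) F D g₀ os S) (hR : RRec₁₁ 𝔯 F D g₀ os R) (hr : RatesAt D R) : letI := S.dec
    ∃ δ : ℕ → ℝ, NE7.Core S.l₀ S.vol S.T S.Bad (fun K t τ => S.A K t τ - S.shA K t τ)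
      (fun K t τ => S.B K t τ - S.shB K t τ) δ ∧ Summable δ := by
  refine (rateEdge_canon_rRec₁₁_iff cr 𝔯).mpr (fun F D h g₀ os k => ?_) F D g₀ os S R hS hR hr
  exact IsDatumOfRecord₁₁C.forall_params
    (P := fun D θ hθ => RatesAt D (rateCarriersOfRecord₁₁ 𝔯 F θ g₀ os k) → letI := (cr F θ hθ g₀ os).dec
      ∃ δ : ℕ → ℝ, NE7.Core (cr F θ hθ g₀ os).l₀ (cr F θ hθ g₀ os).vol (cr F θ hθ g₀ os).T (cr F θ hθ g₀ os).Bad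
        (fun K t τ => (cr F θ hθ g₀ os).A K t τ - (cr F θ hθ g₀ os).shA K t τ)
        (fun K t τ => (cr F θ hθ g₀ os).B K t τ - (cr F θ hθ g₀ os).shB K t τ) δ ∧ Summable δ)
    (fun θ hθ hadm => h19 F θ hθ hadm g₀ os k) h

end Edge

/-! ## §2 N19's DECL target at both homes: the six in-edges BY NAME at `RRec₁₁ 𝔯`, the spine stubs at the canonical spine home, the same-key edge -/

section Target

/-- **N19's DECL TARGET AT BOTH HOMES OF THE RATE-RECORD DIVISION** [bookkeeping].  The six in-edges BY NAME at the (T-RATE) home — `S_N14` (NE1′) ·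
`S_N15` (NE2) · `S_N16` (NE3) · `S_N17` (NE4) · `S_N18` (NE5) · `S_N22` (NE9 ∧ fading memory) at `RRec₁₁ 𝔯` (each ⟺ «the node's estimate at the canonical
objects of every datum of record», n22-e's `s_N1x_rRec₁₁_iff`; K4's existence stub `S_R00x ₁₁C (RRec₁₁ 𝔯)` is n22-e's THEOREM `s_R00x_rRec₁₁`, CONSUMED here)
— the sibling spine stubs `S_N27x ₁₁C` · `S_N20` · `S_N21` at the CANONICAL spine home `SRec₁₁ (canonReading₁₁ cr)`, and the SAME-KEY N19′ edge (§1
`rateEdge_canon_rRec₁₁_iff`'s right side) give `T4ApexVariance.MatchingUnder D END` — N19's DECL target `T4CauchySum.MatchingModConstants vol l₀ δ Z ∧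
Summable δ` string-wise under the prefix — at every `Node00.IsRecordOfRecord₁₁C F N D w`.  Kernel: n27-a XIV `spine_of_rateStubs_coreEdge` at the two homes
(B5 at ₁₁C; no budget half, no `S.δ`), then node U5 at the record (`T4MatchingDegenerate.hybridNE7Under_iff_matchingUnder`, `AvgMeasurable` from the
record).  Every stub and the edge a HYPOTHESIS about the residual readings `cr`, `𝔯`. [folklore] -/
theorem matchingUnder_at_homes₁₁_of_rateStubs
    (h14 : S_N14 (RRec₁₁ 𝔯)) (h15 : S_N15 (RRec₁₁ 𝔯)) (h16 : S_N16 (RRec₁₁ 𝔯)) (h17 : S_N17 (RRec₁₁ 𝔯)) (h18 : S_N18 (RRec₁₁ 𝔯))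
    (h22 : S_N22 (RRec₁₁ 𝔯))
    (hx : S_N27x (fun F D w => IsRecordOfRecord₁₁C F N D w) (SRec₁₁ (canonReading₁₁ cr))) (h20 : S_N20 (SRec₁₁ (canonReading₁₁ cr)))
    (h21 : S_N21 (SRec₁₁ (canonReading₁₁ cr)))
    (h19 : ∀ (F : T4Family) (D : Datum F N) (h : IsDatumOfRecord₁₁C F N D) (g₀ : ℕ → ℝ) (os : List (ULoop F)) (k : ℕ),
      RatesAt D (rateCarriersOfRecord₁₁ 𝔯 F h.params g₀ os k) → letI := (cr F h.params h.provisos g₀ os).dec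
      ∃ δ : ℕ → ℝ, NE7.Core (cr F h.params h.provisos g₀ os).l₀ (cr F h.params h.provisos g₀ os).vol (cr F h.params h.provisos g₀ os).T
        (cr F h.params h.provisos g₀ os).Bad
        (fun K t τ => (cr F h.params h.provisos g₀ os).A K t τ - (cr F h.params h.provisos g₀ os).shA K t τ)
        (fun K t τ => (cr F h.params h.provisos g₀ os).B K t τ - (cr F h.params h.provisos g₀ os).shB K t τ) δ ∧ Summable δ)
    {F : T4Family} {D : Datum F N} {w : DagBinding.WorldP} (hR : IsRecordOfRecord₁₁C F N D w) :
    MatchingUnder D (DagBinding.EndpointExistence D.C.toB12) :=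
  (T4MatchingDegenerate.hybridNE7Under_iff_matchingUnder D (avgMeasurable_of_isRecordOfRecord₁₁C hR) _).mp
    (spine_of_rateStubs_coreEdge (fun F D w => IsRecordOfRecord₁₁C F N D w) (SRec₁₁ (canonReading₁₁ cr)) (RRec₁₁ 𝔯) (s_R00x_rRec₁₁ 𝔯)
      h14 h15 h16 h17 h18 h22 hx h20 h21 ((rateEdge_canon_rRec₁₁_iff cr 𝔯).mpr h19) F D w hR)

/-- **… THE LITERAL `HybridNE7.matchingModConstants` (:183) ROAD, `lt_one` FILLED** [bookkeeping]: the same inputs plus the keyed budget half «`W K + Wsh K < 1`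
at `cr F h.params h.provisos g₀ os`» give the same conclusion through module 1's `stringwiseMatching_at_record₁₁_of_rateStubs` (node U5's datum assembled
field by field at the remainder of record, `summable := summable_deltaOfRecord` displayed — module 1 §1). [folklore] -/
theorem matchingUnder_at_homes₁₁_of_rateStubs_lt_one
    (h14 : S_N14 (RRec₁₁ 𝔯)) (h15 : S_N15 (RRec₁₁ 𝔯)) (h16 : S_N16 (RRec₁₁ 𝔯)) (h17 : S_N17 (RRec₁₁ 𝔯)) (h18 : S_N18 (RRec₁₁ 𝔯))
    (h22 : S_N22 (RRec₁₁ 𝔯))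
    (hx : S_N27x (fun F D w => IsRecordOfRecord₁₁C F N D w) (SRec₁₁ (canonReading₁₁ cr))) (h20 : S_N20 (SRec₁₁ (canonReading₁₁ cr)))
    (h21 : S_N21 (SRec₁₁ (canonReading₁₁ cr)))
    (hlt : ∀ (F : T4Family) (D : Datum F N) (h : IsDatumOfRecord₁₁C F N D) (g₀ : ℕ → ℝ) (os : List (ULoop F)) (K : ℕ),
      (cr F h.params h.provisos g₀ os).W K + (cr F h.params h.provisos g₀ os).Wsh K < 1)
    (h19 : ∀ (F : T4Family) (D : Datum F N) (h : IsDatumOfRecord₁₁C F N D) (g₀ : ℕ → ℝ) (os : List (ULoop F)) (k : ℕ),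
      RatesAt D (rateCarriersOfRecord₁₁ 𝔯 F h.params g₀ os k) → letI := (cr F h.params h.provisos g₀ os).dec
      ∃ δ : ℕ → ℝ, NE7.Core (cr F h.params h.provisos g₀ os).l₀ (cr F h.params h.provisos g₀ os).vol (cr F h.params h.provisos g₀ os).T
        (cr F h.params h.provisos g₀ os).Bad
        (fun K t τ => (cr F h.params h.provisos g₀ os).A K t τ - (cr F h.params h.provisos g₀ os).shA K t τ)
        (fun K t τ => (cr F h.params h.provisos g₀ os).B K t τ - (cr F h.params h.provisos g₀ os).shB K t τ) δ ∧ Summable δ)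
    {F : T4Family} {D : Datum F N} {w : DagBinding.WorldP} (hR : IsRecordOfRecord₁₁C F N D w) :
    MatchingUnder D (DagBinding.EndpointExistence D.C.toB12) :=
  stringwiseMatching_at_record₁₁_of_rateStubs (SRec₁₁ (canonReading₁₁ cr)) (RRec₁₁ 𝔯) (s_R00x_rRec₁₁ 𝔯) h14 h15 h16 h17 h18 h22 hx h20 h21
    (by
      intro F D g₀ os S hS
      obtain ⟨h, rfl⟩ := (sRec₁₁_canon_iff cr D g₀ os S).mp hS
      exact hlt F D h g₀ os)
    ((rateEdge_canon_rRec₁₁_iff cr 𝔯).mpr h19) hR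

end Target

/-! ## §3 From the children's θ-form products: the canonical transfers and the target -/

section ThetaForm

/-- **N21's CANONICAL TRANSFER** [bookkeeping]: NE7c's `ShellWeightBound` at `cr`'s reading of EVERY admissible tuple with provisos (the RHS of n21-d's
`s_N21_keyed₁₁_iff` ∕ n20-e's `s_N21_sRec₁₁_iff`) gives `S_N21` at the canonical spine home (n20-e proved N20's twin `s_N20_sRec₁₁_canon_of_sRec₁₁`). [folklore] -/
theorem s_N21_sRec₁₁_canon_of_forall
    (h21 : ∀ (F : T4Family) (θ : Stage11Params F N) (hP : θ.Provisos₁₁), θ.Admissible → ∀ (g₀ : ℕ → ℝ) (os : List (ULoop F)),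
      ShellWeightBound (cr F θ hP g₀ os).l₀ (cr F θ hP g₀ os).T (cr F θ hP g₀ os).A (cr F θ hP g₀ os).B (cr F θ hP g₀ os).shA
        (cr F θ hP g₀ os).shB (cr F θ hP g₀ os).Wsh) :
    S_N21 (SRec₁₁ (canonReading₁₁ cr)) := by
  intro F D g₀ os S hS
  obtain ⟨h, rfl⟩ := (sRec₁₁_canon_iff cr D g₀ os S).mp hS
  exact h21 F h.params h.provisos h.admissible g₀ os

/-- **N27x's CANONICAL PRODUCER FROM THE KEYED EXTRACTION CLAUSE** [bookkeeping]: if at EVERY admissible tuple with provisos, under (B) and END at its datum,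
for all small tuned `g₀` and every `os`, `cr F θ hP g₀ os` has `0 < l₀`, `0 < vol` and E1∕E2 against the datum's dressed partition functions (n27-c XXII's
`hx` shape), then `S_N27x ₁₁C (SRec₁₁ (canonReading₁₁ cr))`: at a record pair take its datum key `h` and the bundle at `h.params` (pinned by
`sRec₁₁_canon_iff`). [folklore] -/
theorem s_N27x_sRec₁₁_canon_of_forall
    (hx : ∀ (F : T4Family) (θ : Stage11Params F N) (hP : θ.Provisos₁₁), θ.Admissible →
      B16.EndStatementBPrinted (datumOfRecord₁₁ F N θ hP).C → DagBinding.EndpointExistence (datumOfRecord₁₁ F N θ hP).C.toB12 →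
        ForSmallCouplings (datumOfRecord₁₁ F N θ hP) fun g₀ => ∀ os : List (ULoop F),
          0 < (cr F θ hP g₀ os).l₀ ∧ 0 < (cr F θ hP g₀ os).vol ∧
          (∀ (K : ℕ) (t : ℝ), |t| ≤ (cr F θ hP g₀ os).l₀ →
            T4GenFunBounds.schemeZ ((datumOfRecord₁₁ F N θ hP).scheme g₀) os ((cr F θ hP g₀ os).K₀ + K) t =
              ∑ τ ∈ (cr F θ hP g₀ os).T K, (cr F θ hP g₀ os).A K t τ) ∧
          (∀ (K : ℕ) (t : ℝ), |t| ≤ (cr F θ hP g₀ os).l₀ →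
            T4GenFunBounds.schemeZ ((datumOfRecord₁₁ F N θ hP).scheme g₀) os ((cr F θ hP g₀ os).K₀ + K + 1) t =
              ∑ τ ∈ (cr F θ hP g₀ os).T K, (cr F θ hP g₀ os).B K t τ)) :
    S_N27x (fun F D w => IsRecordOfRecord₁₁C F N D w) (SRec₁₁ (canonReading₁₁ cr)) := by
  intro F D w hR hB hEnd
  have h : IsDatumOfRecord₁₁C F N D := Node00.isDatumOfRecord₁₁C_of_isRecordOfRecord₁₁C hR
  have hx' := IsDatumOfRecord₁₁C.forall_params
    (P := fun D θ hθ => B16.EndStatementBPrinted D.C → DagBinding.EndpointExistence D.C.toB12 →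
      ForSmallCouplings D fun g₀ => ∀ os : List (ULoop F),
        0 < (cr F θ hθ g₀ os).l₀ ∧ 0 < (cr F θ hθ g₀ os).vol ∧
        (∀ (K : ℕ) (t : ℝ), |t| ≤ (cr F θ hθ g₀ os).l₀ →
          T4GenFunBounds.schemeZ (D.scheme g₀) os ((cr F θ hθ g₀ os).K₀ + K) t = ∑ τ ∈ (cr F θ hθ g₀ os).T K, (cr F θ hθ g₀ os).A K t τ) ∧
        (∀ (K : ℕ) (t : ℝ), |t| ≤ (cr F θ hθ g₀ os).l₀ →
          T4GenFunBounds.schemeZ (D.scheme g₀) os ((cr F θ hθ g₀ os).K₀ + K + 1) t =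
            ∑ τ ∈ (cr F θ hθ g₀ os).T K, (cr F θ hθ g₀ os).B K t τ))
    (fun θ hθ hadm => hx F θ hθ hadm) h hB hEnd
  refine hx'.mono fun g₀ hg os => ?_
  obtain ⟨hl₀, hvol, hZA, hZB⟩ := hg os
  exact ⟨cr F h.params h.provisos g₀ os, (sRec₁₁_canon_iff cr D g₀ os _).mpr ⟨h, rfl⟩, hl₀, hvol, hZA, hZB⟩

/-- **N19's DECL TARGET AT BOTH HOMES FROM THE CHILDREN's θ-FORM PRODUCTS** [bookkeeping]: N20's `RelWeightBound` and N21's `ShellWeightBound` at `cr F θ hP g₀ os`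
for EVERY admissible θ with provisos (the RHS of `s_N20_sRec₁₁_iff` ∕ `s_N21_sRec₁₁_iff`), the six in-edges BY NAME at `RRec₁₁ 𝔯`, the same-key N19′ edge in
θ-form at every run length, and the keyed extraction clause under the prefix ⇒ `MatchingUnder D END` at every ₁₁C record (§2 with the canonical transfers:
n20-e's `s_N20_sRec₁₁_canon_of_sRec₁₁`, `s_N21_sRec₁₁_canon_of_forall`, `s_N27x_sRec₁₁_canon_of_forall`, `rateEdge_canon_rRec₁₁_of_forall_admissible`). [folklore] -/
theorem matchingUnder_at_homes₁₁_of_forall_admissible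
    (h20 : ∀ (F : T4Family) (θ : Stage11Params F N) (hP : θ.Provisos₁₁), θ.Admissible → ∀ (g₀ : ℕ → ℝ) (os : List (ULoop F)),
      RelWeightBound (cr F θ hP g₀ os).l₀ (cr F θ hP g₀ os).T (cr F θ hP g₀ os).A (cr F θ hP g₀ os).B (cr F θ hP g₀ os).Bad
        (cr F θ hP g₀ os).W)
    (h21 : ∀ (F : T4Family) (θ : Stage11Params F N) (hP : θ.Provisos₁₁), θ.Admissible → ∀ (g₀ : ℕ → ℝ) (os : List (ULoop F)),
      ShellWeightBound (cr F θ hP g₀ os).l₀ (cr F θ hP g₀ os).T (cr F θ hP g₀ os).A (cr F θ hP g₀ os).B (cr F θ hP g₀ os).shA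
        (cr F θ hP g₀ os).shB (cr F θ hP g₀ os).Wsh)
    (h14 : S_N14 (RRec₁₁ 𝔯)) (h15 : S_N15 (RRec₁₁ 𝔯)) (h16 : S_N16 (RRec₁₁ 𝔯)) (h17 : S_N17 (RRec₁₁ 𝔯)) (h18 : S_N18 (RRec₁₁ 𝔯))
    (h22 : S_N22 (RRec₁₁ 𝔯))
    (h19 : ∀ (F : T4Family) (θ : Stage11Params F N) (hP : θ.Provisos₁₁), θ.Admissible → ∀ (g₀ : ℕ → ℝ) (os : List (ULoop F)) (k : ℕ),
      RatesAt (datumOfRecord₁₁ F N θ hP) (rateCarriersOfRecord₁₁ 𝔯 F θ g₀ os k) → letI := (cr F θ hP g₀ os).dec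
      ∃ δ : ℕ → ℝ, NE7.Core (cr F θ hP g₀ os).l₀ (cr F θ hP g₀ os).vol (cr F θ hP g₀ os).T (cr F θ hP g₀ os).Bad
        (fun K t τ => (cr F θ hP g₀ os).A K t τ - (cr F θ hP g₀ os).shA K t τ)
        (fun K t τ => (cr F θ hP g₀ os).B K t τ - (cr F θ hP g₀ os).shB K t τ) δ ∧ Summable δ)
    (hx : ∀ (F : T4Family) (θ : Stage11Params F N) (hP : θ.Provisos₁₁), θ.Admissible →
      B16.EndStatementBPrinted (datumOfRecord₁₁ F N θ hP).C → DagBinding.EndpointExistence (datumOfRecord₁₁ F N θ hP).C.toB12 →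
        ForSmallCouplings (datumOfRecord₁₁ F N θ hP) fun g₀ => ∀ os : List (ULoop F),
          0 < (cr F θ hP g₀ os).l₀ ∧ 0 < (cr F θ hP g₀ os).vol ∧
          (∀ (K : ℕ) (t : ℝ), |t| ≤ (cr F θ hP g₀ os).l₀ →
            T4GenFunBounds.schemeZ ((datumOfRecord₁₁ F N θ hP).scheme g₀) os ((cr F θ hP g₀ os).K₀ + K) t =
              ∑ τ ∈ (cr F θ hP g₀ os).T K, (cr F θ hP g₀ os).A K t τ) ∧
          (∀ (K : ℕ) (t : ℝ), |t| ≤ (cr F θ hP g₀ os).l₀ →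
            T4GenFunBounds.schemeZ ((datumOfRecord₁₁ F N θ hP).scheme g₀) os ((cr F θ hP g₀ os).K₀ + K + 1) t =
              ∑ τ ∈ (cr F θ hP g₀ os).T K, (cr F θ hP g₀ os).B K t τ))
    {F : T4Family} {D : Datum F N} {w : DagBinding.WorldP} (hR : IsRecordOfRecord₁₁C F N D w) :
    MatchingUnder D (DagBinding.EndpointExistence D.C.toB12) :=
  (T4MatchingDegenerate.hybridNE7Under_iff_matchingUnder D (avgMeasurable_of_isRecordOfRecord₁₁C hR) _).mp
    (spine_of_rateStubs_coreEdge (fun F D w => IsRecordOfRecord₁₁C F N D w) (SRec₁₁ (canonReading₁₁ cr)) (RRec₁₁ 𝔯) (s_R00x_rRec₁₁ 𝔯)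
      h14 h15 h16 h17 h18 h22 (s_N27x_sRec₁₁_canon_of_forall cr hx)
      (s_N20_sRec₁₁_canon_of_sRec₁₁ cr ((s_N20_sRec₁₁_iff cr).mpr h20)) (s_N21_sRec₁₁_canon_of_forall cr h21)
      (rateEdge_canon_rRec₁₁_of_forall_admissible cr 𝔯 h19) F D w hR)

end ThetaForm

end Summit.QuantumFields.YangMills.BalabanUVNodes.N19TargetAtHomes11

end
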